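import Mathlib
import Summits.MatrixMultiplication.MatrixMultiplication.Theorems.SubgroupIdentityDesigns.Negative.FibreGhost

/-!
# Re-indexing the fibre rows by lines (negative-side bookkeeping lemma for the crux `SubgroupIdentityDesigns`,
stmt-MatrixMultiplication-14079; cell B2b-5, gen 7 — report `run/shared/lean/b2b/levelgraded-cu/ORACLE-g7.md` §G7-1)

On a set `S` of INVERTIBLE matrices the span of all fibre indicators `s ↦ [s a = w]` (`a, w` arbitrary) is already
spanned by the rows `s ↦ [s u_l = w]` with `u_l` running over representatives of the lines (any family `u` such that
every non-zero vector is a non-zero multiple of some `u_l`) and `w ≠ 0` (`fibreRow_mem_span_lineRows`):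
`[s (c u_l) = w] = [s u_l = c⁻¹ w]`, rows with `w = 0 ≠ a` vanish on invertible `s`, and the constant row (`a = w = 0`)
is `Σ_{w ≠ 0} [s u_l = w]`.  With `LevelOneSpan.single_mem_restrict_span_of_design` this puts every delta `δ_{a₀g₀}` (`a₀ ∈ H₁`, `g₀ ∈ H₃`), as a
function on `S = H₁H₂H₃`, into the span of the `(#lines)·(p²-1)` line rows restricted to `S` — for `p = 11` the 1440
rows of the census matrix `M_S`, so `RankSplit` and `LeftKernelBound` apply to `M_S` verbatim.  Sorry-free.  VALUE = soundness lemma for a certificate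
format, NOT summit progress.
-/

set_option linter.dupNamespace false

noncomputable section

open scoped BigOperators Classical
open Matrix
open Summit.MatrixMultiplication.MatrixMultiplication.Theorems.LieRankDesigns.Negative (GLm Mat)

namespace Summit.MatrixMultiplication.MatrixMultiplication.Theorems.SubgroupIdentityDesigns.Negative

namespace LineRows

variable {p : ℕ} [Fact p.Prime]

/-- An invertible matrix kills no non-zero vector. -/
theorem mulVec_ne_zero_of_isUnit_det (s : CMat p 2) (hs : IsUnit s.det) (v : Fin 2 → ZMod p) (hv : v ≠ 0) :
    s.mulVec v ≠ 0 := by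
  intro h
  apply hv
  have : (s⁻¹ * s).mulVec v = 0 := by rw [← Matrix.mulVec_mulVec, h, Matrix.mulVec_zero]
  rwa [Matrix.nonsing_inv_mul _ hs, Matrix.one_mulVec] at this

/-- Every fibre indicator restricted to a set of invertible matrices is a combination of LINE ROWS
`s ↦ [s u_l = w]`, `w ≠ 0`. -/
theorem fibreRow_mem_span_lineRows {L : Type*} [Fintype L] (u : L → (Fin 2 → ZMod p))
    (hu : ∀ a : Fin 2 → ZMod p, a ≠ 0 → ∃ l, ∃ c : ZMod p, c ≠ 0 ∧ a = c • u l)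
    (S : Set (CMat p 2)) (hS : ∀ s ∈ S, IsUnit (s : CMat p 2).det) (a w : Fin 2 → ZMod p) :
    (fun s : S => if (s : CMat p 2).mulVec a = w then (1 : ℂ) else 0) ∈ Submodule.span ℂ
      (Set.range fun lw : L × {w : Fin 2 → ZMod p // w ≠ 0} =>
        fun s : S => if (s : CMat p 2).mulVec (u lw.1) = lw.2.1 then (1 : ℂ) else 0) := by
  by_cases ha : a = 0
  · subst ha
    by_cases hw : w = 0
    · subst hw
      -- the constant row 1 = Σ_{w' ≠ 0} [s u_{l₀} = w']
      have he : (![1, 0] : Fin 2 → ZMod p) ≠ 0 := by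
        intro h; have := congrFun h 0; simp at this
      obtain ⟨l₀, c, hc, hl₀⟩ := hu _ he
      have hul : u l₀ ≠ 0 := by
        intro h; apply he; rw [hl₀, h, smul_zero]
      have hrow : (fun s : S => if (s : CMat p 2).mulVec 0 = (0 : Fin 2 → ZMod p) then (1 : ℂ) else 0) =
          ∑ w' : {w : Fin 2 → ZMod p // w ≠ 0},
            fun s : S => if (s : CMat p 2).mulVec (u l₀) = w'.1 then (1 : ℂ) else 0 := by
        funext s
        simp only [Matrix.mulVec_zero, if_true, Finset.sum_apply]
        have hv : (s : CMat p 2).mulVec (u l₀) ≠ 0 := mulVec_ne_zero_of_isUnit_det _ (hS s s.2) _ hul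
        rw [Fintype.sum_eq_single (⟨(s : CMat p 2).mulVec (u l₀), hv⟩ : {w : Fin 2 → ZMod p // w ≠ 0})]
        · simp
        · intro w' hw'
          rw [if_neg]
          intro h
          apply hw'
          exact Subtype.ext h.symm
      rw [hrow]
      exact Submodule.sum_mem _ fun w' _ => Submodule.subset_span ⟨(l₀, w'), rfl⟩
    · -- the row [0 = w], w ≠ 0, is zero
      have hrow : (fun s : S => if (s : CMat p 2).mulVec 0 = w then (1 : ℂ) else 0) = 0 := by
        funext s
        simp only [Matrix.mulVec_zero, Pi.zero_apply]
        rw [if_neg]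
        exact fun h => hw h.symm
      rw [hrow]
      exact Submodule.zero_mem _
  · obtain ⟨l, c, hc, rfl⟩ := hu a ha
    have hul : u l ≠ 0 := by
      intro h; apply ha; rw [h, smul_zero]
    by_cases hw : w = 0
    · subst hw
      have hrow : (fun s : S => if (s : CMat p 2).mulVec (c • u l) = (0 : Fin 2 → ZMod p) then (1 : ℂ) else 0)
          = 0 := by
        funext s
        simp only [Pi.zero_apply]
        rw [if_neg]
        rw [Matrix.mulVec_smul]
        exact smul_ne_zero hc (mulVec_ne_zero_of_isUnit_det _ (hS s s.2) _ hul)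
      rw [hrow]
      exact Submodule.zero_mem _
    · have hw' : c⁻¹ • w ≠ 0 := smul_ne_zero (inv_ne_zero hc) hw
      have hrow : (fun s : S => if (s : CMat p 2).mulVec (c • u l) = w then (1 : ℂ) else 0) =
          fun s : S => if (s : CMat p 2).mulVec (u l) = c⁻¹ • w then (1 : ℂ) else 0 := by
        funext s
        rw [Matrix.mulVec_smul]
        congr 1
        exact propext (eq_inv_smul_iff₀ hc).symm
      rw [hrow]
      exact Submodule.subset_span ⟨(l, ⟨c⁻¹ • w, hw'⟩), rfl⟩

end LineRows

end Summit.MatrixMultiplication.MatrixMultiplication.Theorems.SubgroupIdentityDesigns.Negative
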